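import Literature.MathematicalPhysics.QuantumFieldTheory.Balaban1983to89.B9Thm313WholeLettersCut

/-!
# `Balaban1983to89.B9Thm313WholeLettersCutKept` — [B9] Theorem 3.13 (p. 426): the KEPT-FIELD sub-records of the letters-species re-cut schemas
# `Letters313Zc ∕ Letters313L2Pc` (dag-n06-l g19 `B9Thm313WholeLettersCut`), so that a consumer can DISPLAY the kept printed letters and SUPPLY the
# re-cut's new letters (`gXH wGp` ∕ `vDRDG vGDRD`) from their landed derivations (`B9Thm313WholeCutLettersSupFrom344` ∕ `B9Thm313WholeCutLettersL2From3152`)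

T. Bałaban, *Propagators for lattice gauge theories in a background field*, Commun. Math. Phys. **99** (1985) 389–434 [`Balaban1985BackgroundPropagators`,
"B9"]; [4] = T. Bałaban, *Propagators and renormalization transformations for lattice gauge theories. II*, Commun. Math. Phys. **96** (1984) 223–250
[`Balaban1984PropagatorsII`].  statement-level skeleton of published theorems with citation tags; proofs where landed; nothing here is a claim about
the Yang–Mills mass gap.

THE POINT (cell `pub-ymgap`, node N06 [B9], rows 20–21; knit seat dag-n06-d g12, after dag-n06-l g19's re-cut and its two supplier files).  The d = 4
certificate (edition 38, `…N06AtOpsYNuOfRecordV6EPairNS`) displays the re-cut records WHOLE: `hletters13 : … Letters313Zc (𝔬12 x) (Gp x) … (bXH x) U` and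
`hLL2 : … Letters313L2Pc (𝔬12 x) … ∧ …`.  Of their fields, the re-cut's NEW letters have landed derivations at the schema level — `vDRDG ∕ vGDRD`
(`B9Thm313WholeCutLettersL2From3152.vDRDG_of_ids3152 ∕ vGDRD_of_ids3152`: the identity (3.152), (3.46)₄ for DG′D\*, Thm 3.1, (3.49)) and `gXH ∕ wGp`
(`B9Thm313WholeCutLettersSupFrom344.gXH_of_closure ∕ wGp_of_h44Gp`).  To CONSUME them an edition must display the records MINUS those fields; THIS FILE
types the two sub-records and the repackaging, nothing else:
* §1 ★ `Letters313L2Pk 𝔬 Dd Dds R₀ H₀ B₄ δ vZ hvZ U` — `Letters313L2Pc`'s fields `gDv dGDv gQs ddGQs dGQs rgdI rgdDs c1 q` VERBATIM (no `vDRDG ∕ vGDRD`);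
  `Letters313L2Pc.toKept`; `Letters313L2Pc.of_kept` (kept record + the two block-L² statements ⟹ the cut record); `Letters313L2Pk.mono` (constant UP,
  rate DOWN — to meet the supplied letters' constant∕rate);
* §2 ★ `Letters313Zk 𝔬 R₀ H₀ hG wZ hwZ B₃ δ₃ U` — `Letters313Zc`'s fields `gD2 gQs2 gQs1 rgd2 c1_2 c1_1 q2 q1` VERBATIM (no `gXH ∕ wGp`, hence no
  `Gp ∕ bXH` parameters); `Letters313Zc.toKept`; `Letters313Zc.of_kept` (kept record + the `gXH` statement at `bXH` + the `wGp` statement at `Gp, bXH` ⟹ the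
  cut record); `Letters313Zk.mono`.
HONEST SCOPE.  HYPOTHESIS SCHEMAS and field bookkeeping (anonymous constructors ∕ projections); nothing of [B9]'s estimates is asserted; count-neutral;
N06 NOT discharged; one finite lattice at a time — nothing continuum ∕ ℝ⁴ ∕ OS ∕ mass gap ∕ Clay.  Cell `pub-ymgap` (HUMAN RULING D-0062), Track A node
N06 [B9], rows 20–21, knit seat `pub-ymgap-dag-n06-d` (g12), 2026-08-28.  NEW file; `Letters313Zc ∕ Letters313L2Pc` untouched.
-/

namespace Literature.MathematicalPhysics.QuantumFieldTheory.Balaban1983to89.B9Thm313WholeLettersCutKept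

open Literature.MathematicalPhysics.QuantumFieldTheory.Balaban1983to89
open B9Thm34Ext B11SectG B9SectDSup B9SectDL2Decay B9Thm312Whole B9Thm312WholeClasses B9Thm313WholeHolderZ
open B9Thm313WholeLettersCut

noncomputable section

/-! ## §1 The kept block-L² letters of `Letters313L2Pc` -/

section L2

variable {g : B9.Geometry} {B : B9.Backgrounds} {X Y Z W P : Type} [Fintype X] [Fintype Y] [Fintype Z] [Fintype W] [Fintype g.Site]
variable {R₀ : ℝ} {H₀ : Prop}

/-- ★ **THE KEPT BLOCK-L² LETTERS OF THE RE-CUT SCHEMA** — `B9Thm313WholeLettersCut.Letters313L2Pc` WITHOUT its two re-cut letters `vDRDG` (D·R·D\*·G₁) and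
`vGDRD` (G₁·D·R·D\*): the fields `gDv dGDv gQs ddGQs dGQs rgdI rgdDs c1 q` VERBATIM ((3.46)-type block-L² lines of G₀D, DG₀D, G₀Q\*, ∇∇G₀Q\*, DG₀Q\*,
R·D\*·G₁, R·D\*·G₁·D\*, C₁, Q with the len-ratio factors of the pair-M road).  A HYPOTHESIS SCHEMA; nothing asserted.
[cite: Balaban1985BackgroundPropagators, Thm 3.13 p.426 + (3.46) p.398 + (3.152)–(3.153) p.426] -/
structure Letters313L2Pk (𝔬 : Ops g B X Y Z W) (Dd Dds : B.Cfg → P → Module.End ℝ (X → ℝ)) (R₀ : ℝ) (H₀ : Prop) (B₄ δ : ℝ)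
    (vZ : g.Site → ℝ) (hvZ : ∀ y, 0 < vZ y) (U : B.Cfg) : Prop where
  gDv : BlockBd (g := toB6 g R₀ H₀) 𝔬.blkW 𝔬.blk (𝔬.G0 U ∘ₗ 𝔬.Dv U)
    (fun (y y' : g.Site) => B₄ * g.len y * Real.exp (-(δ * g.dist y y')))
  dGDv : BlockBd (g := toB6 g R₀ H₀) 𝔬.blkW 𝔬.blkY (𝔬.D U ∘ₗ 𝔬.G0 U ∘ₗ 𝔬.Dv U)
    (fun (y y' : g.Site) => B₄ * Real.exp (-(δ * g.dist y y')))
  gQs : BlockBd (g := toB6 g R₀ H₀) 𝔬.blkZ 𝔬.blk (𝔬.G0 U ∘ₗ 𝔬.Qstar U)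
    (fun (y y' : g.Site) => B₄ * g.len y * (vZ y' * g.len y') * Real.exp (-(δ * g.dist y y')))
  ddGQs : ∀ q : P × P, BlockBd (g := toB6 g R₀ H₀) 𝔬.blkZ 𝔬.blk ((Dd U q.1 ∘ₗ Dd U q.2) ∘ₗ 𝔬.G0 U ∘ₗ 𝔬.Qstar U)
    (fun (y y' : g.Site) => B₄ * ((g.len y)⁻¹ * (vZ y' * g.len y')) * Real.exp (-(δ * g.dist y y')))
  dGQs : BlockBd (g := toB6 g R₀ H₀) 𝔬.blkZ 𝔬.blkY (𝔬.D U ∘ₗ 𝔬.G0 U ∘ₗ 𝔬.Qstar U)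
    (fun (y y' : g.Site) => B₄ * (vZ y' * g.len y') * Real.exp (-(δ * g.dist y y')))
  rgdI : BlockBd (g := toB6 g R₀ H₀) 𝔬.blk 𝔬.blkW (𝔬.R U ∘ₗ 𝔬.Dvstar U ∘ₗ 𝔬.G1 U ∘ₗ LinearMap.id)
    (fun (y y' : g.Site) => B₄ * g.len y' * Real.exp (-(δ * g.dist y y')))
  rgdDs : BlockBd (g := toB6 g R₀ H₀) 𝔬.blkY 𝔬.blkW (𝔬.R U ∘ₗ 𝔬.Dvstar U ∘ₗ 𝔬.G1 U ∘ₗ 𝔬.Dstar U)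
    (fun (y y' : g.Site) => B₄ * Real.exp (-(δ * g.dist y y')))
  c1 : BlockBd (g := toB6 g R₀ H₀) 𝔬.blkZ 𝔬.blkZ (𝔬.C1 U)
    (fun (y y' : g.Site) => B₄ * (vZ y * g.len y)⁻¹ * (vZ y' * g.len y')⁻¹ * Real.exp (-(δ * g.dist y y')))
  q : BlockBd (g := toB6 g R₀ H₀) 𝔬.blk 𝔬.blkZ (𝔬.Q U)
    (fun (y y' : g.Site) => B₄ * (vZ y * g.len y * (g.len y')⁻¹) * Real.exp (-(δ * g.dist y y')))

/-- the kept sub-record of a cut record (projections). [cite: Balaban1985BackgroundPropagators, Thm 3.13 p.426 (bookkeeping)] -/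
theorem Letters313L2Pc.toKept {𝔬 : Ops g B X Y Z W} {Dd Dds : B.Cfg → P → Module.End ℝ (X → ℝ)} {B₄ δ : ℝ} {vZ : g.Site → ℝ}
    {hvZ : ∀ y, 0 < vZ y} {U : B.Cfg} (h : Letters313L2Pc 𝔬 Dd Dds R₀ H₀ B₄ δ vZ hvZ U) :
    Letters313L2Pk 𝔬 Dd Dds R₀ H₀ B₄ δ vZ hvZ U :=
  ⟨h.gDv, h.dGDv, h.gQs, h.ddGQs, h.dGQs, h.rgdI, h.rgdDs, h.c1, h.q⟩

/-- ★ **THE CUT RECORD FROM ITS KEPT FIELDS AND THE TWO RE-CUT BLOCK-L² LETTERS** — the consumer's repackaging: the kept record (displayed) + the statements of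
`vDRDG` (D·R·D\*·G₁) and `vGDRD` (G₁·D·R·D\*) (supplied, e.g. by `B9Thm313WholeCutLettersL2From3152.vDRDG_of_ids3152 ∕ vGDRD_of_ids3152`) give `Letters313L2Pc`.
[cite: Balaban1985BackgroundPropagators, Thm 3.13 p.426 + (3.46) p.398 + (3.152) p.426 (bookkeeping)] -/
theorem Letters313L2Pc.of_kept {𝔬 : Ops g B X Y Z W} {Dd Dds : B.Cfg → P → Module.End ℝ (X → ℝ)} {B₄ δ : ℝ} {vZ : g.Site → ℝ}
    {hvZ : ∀ y, 0 < vZ y} {U : B.Cfg} (h : Letters313L2Pk 𝔬 Dd Dds R₀ H₀ B₄ δ vZ hvZ U)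
    (hDRDG : BlockBd (g := toB6 g R₀ H₀) 𝔬.blk 𝔬.blk (𝔬.Dv U ∘ₗ 𝔬.R U ∘ₗ 𝔬.Dvstar U ∘ₗ 𝔬.G1 U)
      (fun (y y' : g.Site) => B₄ * ((g.len y)⁻¹ * g.len y') * Real.exp (-(δ * g.dist y y'))))
    (hGDRD : BlockBd (g := toB6 g R₀ H₀) 𝔬.blk 𝔬.blk (𝔬.G1 U ∘ₗ 𝔬.Dv U ∘ₗ 𝔬.R U ∘ₗ 𝔬.Dvstar U)
      (fun (y y' : g.Site) => B₄ * (g.len y * (g.len y')⁻¹) * Real.exp (-(δ * g.dist y y')))) :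
    Letters313L2Pc 𝔬 Dd Dds R₀ H₀ B₄ δ vZ hvZ U :=
  ⟨h.gDv, h.dGDv, h.gQs, h.ddGQs, h.dGQs, h.rgdI, h.rgdDs, h.c1, h.q, hDRDG, hGDRD⟩

/-- the kept block-L² letters at WEAKER letters — constant UP (`B₄ ≤ B₄′`) and rate DOWN (`δ′ ≤ δ`); the consumer's device for meeting the constant∕rate
at which the two re-cut letters are supplied. [cite: Balaban1985BackgroundPropagators, (3.46) p.398 (bookkeeping); Balaban1984PropagatorsII, (2.51)–(2.54) p.232] -/
theorem Letters313L2Pk.mono {𝔬 : Ops g B X Y Z W} {Dd Dds : B.Cfg → P → Module.End ℝ (X → ℝ)} {B₄ B₄' δ δ' : ℝ} {U : B.Cfg}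
    (hG : GeoOK g) (hB₄ : 0 ≤ B₄) (hBB : B₄ ≤ B₄') (hδ : δ' ≤ δ) {vZ : g.Site → ℝ} {hvZ : ∀ y, 0 < vZ y}
    (h : Letters313L2Pk 𝔬 Dd Dds R₀ H₀ B₄ δ vZ hvZ U) : Letters313L2Pk 𝔬 Dd Dds R₀ H₀ B₄' δ' vZ hvZ U := by
  have hB₄' : 0 ≤ B₄' := hB₄.trans hBB
  have hexp : ∀ y y' : g.Site, Real.exp (-(δ * g.dist y y')) ≤ Real.exp (-(δ' * g.dist y y')) := fun y y' =>
    Real.exp_le_exp.mpr (neg_le_neg (mul_le_mul_of_nonneg_right hδ (hG.dnn y y')))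
  have hl : ∀ y : g.Site, 0 ≤ g.len y := hG.lenle
  have hli : ∀ y : g.Site, 0 ≤ (g.len y)⁻¹ := fun y => inv_nonneg.mpr (hl y)
  have hv : ∀ y : g.Site, 0 ≤ vZ y * g.len y := fun y => (mul_pos (hvZ y) (hG.lenpos y)).le
  have hvi : ∀ y : g.Site, 0 ≤ (vZ y * g.len y)⁻¹ := fun y => inv_nonneg.mpr (hv y)
  -- `B₄·e ≤ B₄′·e′`, `B₄·w·e ≤ B₄′·w·e′`, `B₄·w·w′·e ≤ B₄′·w·w′·e′` for nonnegative weights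
  have k1 : ∀ y y' : g.Site, B₄ * Real.exp (-(δ * g.dist y y')) ≤ B₄' * Real.exp (-(δ' * g.dist y y')) := fun y y' =>
    mul_le_mul hBB (hexp y y') (Real.exp_nonneg _) hB₄'
  have k2 : ∀ {w : ℝ}, 0 ≤ w → ∀ y y' : g.Site,
      B₄ * w * Real.exp (-(δ * g.dist y y')) ≤ B₄' * w * Real.exp (-(δ' * g.dist y y')) := fun hw y y' =>
    mul_le_mul (mul_le_mul_of_nonneg_right hBB hw) (hexp y y') (Real.exp_nonneg _) (mul_nonneg hB₄' hw)
  have k3 : ∀ {w w' : ℝ}, 0 ≤ w → 0 ≤ w' → ∀ y y' : g.Site,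
      B₄ * w * w' * Real.exp (-(δ * g.dist y y')) ≤ B₄' * w * w' * Real.exp (-(δ' * g.dist y y')) := fun hw hw' y y' =>
    mul_le_mul (mul_le_mul_of_nonneg_right (mul_le_mul_of_nonneg_right hBB hw) hw') (hexp y y') (Real.exp_nonneg _)
      (mul_nonneg (mul_nonneg hB₄' hw) hw')
  exact
    { gDv := h.gDv.mono fun y y' => k2 (hl y) y y'
      dGDv := h.dGDv.mono fun y y' => k1 y y'
      gQs := h.gQs.mono fun y y' => k3 (hl y) (hv y') y y'
      ddGQs := fun q => (h.ddGQs q).mono fun y y' => k2 (mul_nonneg (hli y) (hv y')) y y'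
      dGQs := h.dGQs.mono fun y y' => k2 (hv y') y y'
      rgdI := h.rgdI.mono fun y y' => k2 (hl y') y y'
      rgdDs := h.rgdDs.mono fun y y' => k1 y y'
      c1 := h.c1.mono fun y y' => k3 (hvi y) (hvi y') y y'
      q := h.q.mono fun y y' => k2 (mul_nonneg (hv y) (hli y')) y y' }

end L2

/-! ## §2 The kept sup letters of `Letters313Zc` -/

section Letters

variable {g : B9.Geometry} {B : B9.Backgrounds} {X Y Z W PX PY P : Type}
variable [Fintype X] [Fintype Y] [Fintype Z] [Fintype W] [Fintype PX] [Fintype PY] [Fintype g.Site]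
variable {R₀ : ℝ} {H₀ : Prop}

/-- ★ **THE KEPT SUP LETTERS OF THE RE-CUT SCHEMA** — `B9Thm313WholeLettersCut.Letters313Zc` WITHOUT its two re-cut letters `gXH` (G₁∇\*_U : Y⁰ → `bXH`) and `wGp`
(D·G′·R·D\* : `bXH` → 𝔠⁽¹⁾): the fields `gD2 gQs2 gQs1 rgd2 c1_2 c1_1 q2 q1` VERBATIM (so NO `Gp ∕ bXH` parameters).  A HYPOTHESIS SCHEMA; nothing asserted.
[cite: Balaban1985BackgroundPropagators, Thm 3.13 p.426 + (3.42) p.397 + (3.152)–(3.153) p.426] -/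
structure Letters313Zk (𝔬 : Ops g B X Y Z W) (R₀ : ℝ) (H₀ : Prop) (hG : GeoOK g) (wZ : g.Site → ℝ) (hwZ : ∀ y, 0 < wZ y) (B₃ δ₃ : ℝ)
    (U : B.Cfg) : Prop where
  gD2 : HasMaj (cNorm R₀ H₀ 𝔬.blkW hG.lenle 1) (cNorm R₀ H₀ 𝔬.blk hG.lenle 2) (𝔬.G0 U ∘ₗ 𝔬.Dv U)
    (fun a b => B₃ * Real.exp (-(δ₃ * g.dist a b)))
  gQs2 : HasMaj (weightNorm (BlockNorm.ofBlocks (toB6 g R₀ H₀) 𝔬.blkZ) wZ fun y => (hwZ y).le) (cNorm R₀ H₀ 𝔬.blk hG.lenle 2)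
    (𝔬.G0 U ∘ₗ 𝔬.Qstar U)
    (fun a b => B₃ * Real.exp (-(δ₃ * g.dist a b)))
  gQs1 : HasMaj (weightNorm (BlockNorm.ofBlocks (toB6 g R₀ H₀) 𝔬.blkZ) (fun y => g.len y * wZ y) fun y => (B9Thm313WholeZ.wZlen_pos hG hwZ y).le)
    (cNorm R₀ H₀ 𝔬.blk hG.lenle 1) (𝔬.G0 U ∘ₗ 𝔬.Qstar U) (fun a b => B₃ * Real.exp (-(δ₃ * g.dist a b)))
  rgd2 : HasMaj (cNorm R₀ H₀ 𝔬.blk hG.lenle 0) (cNorm R₀ H₀ 𝔬.blkW hG.lenle 1) (𝔬.R U ∘ₗ 𝔬.Dvstar U ∘ₗ 𝔬.G1 U ∘ₗ LinearMap.id)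
    (fun a b => B₃ * Real.exp (-(δ₃ * g.dist a b)))
  c1_2 : HasMaj (cNorm R₀ H₀ 𝔬.blkZ hG.lenle 2) (weightNorm (BlockNorm.ofBlocks (toB6 g R₀ H₀) 𝔬.blkZ) wZ fun y => (hwZ y).le) (𝔬.C1 U)
    (fun a b => B₃ * Real.exp (-(δ₃ * g.dist a b)))
  c1_1 : HasMaj (cNorm R₀ H₀ 𝔬.blkZ hG.lenle 1)
    (weightNorm (BlockNorm.ofBlocks (toB6 g R₀ H₀) 𝔬.blkZ) (fun y => g.len y * wZ y) fun y => (B9Thm313WholeZ.wZlen_pos hG hwZ y).le) (𝔬.C1 U)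
    (fun a b => B₃ * Real.exp (-(δ₃ * g.dist a b)))
  q2 : HasMaj (cNorm R₀ H₀ 𝔬.blk hG.lenle 2) (cNorm R₀ H₀ 𝔬.blkZ hG.lenle 2) (𝔬.Q U) (fun a b => B₃ * Real.exp (-(δ₃ * g.dist a b)))
  q1 : HasMaj (cNorm R₀ H₀ 𝔬.blk hG.lenle 1) (cNorm R₀ H₀ 𝔬.blkZ hG.lenle 1) (𝔬.Q U) (fun a b => B₃ * Real.exp (-(δ₃ * g.dist a b)))

/-- the kept sub-record of a cut record (projections). [cite: Balaban1985BackgroundPropagators, Thm 3.13 p.426 (bookkeeping)] -/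
theorem Letters313Zc.toKept {𝔬 : Ops g B X Y Z W} {Gp : B.Cfg → Module.End ℝ (W → ℝ)} {bXH : BlockNorm (toB6 g R₀ H₀) (X → ℝ)} {hG : GeoOK g}
    {wZ : g.Site → ℝ} {hwZ : ∀ y, 0 < wZ y} {B₃ δ₃ : ℝ} {U : B.Cfg} (h : Letters313Zc 𝔬 Gp R₀ H₀ hG wZ hwZ B₃ δ₃ bXH U) :
    Letters313Zk 𝔬 R₀ H₀ hG wZ hwZ B₃ δ₃ U :=
  ⟨h.gD2, h.gQs2, h.gQs1, h.rgd2, h.c1_2, h.c1_1, h.q2, h.q1⟩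

/-- ★ **THE CUT RECORD FROM ITS KEPT FIELDS AND THE TWO RE-CUT SUP LETTERS** — the consumer's repackaging: the kept record (displayed) + the statements of
`gXH` (G₁∇\*_U : Y⁰ → `bXH`, e.g. `B9Thm313WholeCutLettersSupFrom344.gXH_of_closure`) and `wGp` (D·G′·R·D\* : `bXH` → 𝔠⁽¹⁾, e.g. `…wGp_of_h44Gp`) give `Letters313Zc … Gp … bXH U`.
[cite: Balaban1985BackgroundPropagators, Thm 3.13 p.426 + (3.42)–(3.44) pp.397–398 + (3.152) p.426 (bookkeeping)] -/
theorem Letters313Zc.of_kept {𝔬 : Ops g B X Y Z W} {Gp : B.Cfg → Module.End ℝ (W → ℝ)} {bXH : BlockNorm (toB6 g R₀ H₀) (X → ℝ)} {hG : GeoOK g}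
    {wZ : g.Site → ℝ} {hwZ : ∀ y, 0 < wZ y} {B₃ δ₃ : ℝ} {U : B.Cfg} (h : Letters313Zk 𝔬 R₀ H₀ hG wZ hwZ B₃ δ₃ U)
    (hXH : HasMaj (cNorm R₀ H₀ 𝔬.blkY hG.lenle 0) bXH (𝔬.G1 U ∘ₗ 𝔬.Dstar U) (fun a b => B₃ * Real.exp (-(δ₃ * g.dist a b))))
    (hW : HasMaj bXH (cNorm R₀ H₀ 𝔬.blk hG.lenle 1) (𝔬.Dv U ∘ₗ Gp U ∘ₗ 𝔬.R U ∘ₗ 𝔬.Dvstar U)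
      (fun a b => B₃ * Real.exp (-(δ₃ * g.dist a b)))) :
    Letters313Zc 𝔬 Gp R₀ H₀ hG wZ hwZ B₃ δ₃ bXH U :=
  ⟨h.gD2, h.gQs2, h.gQs1, h.rgd2, h.c1_2, h.c1_1, h.q2, h.q1, hXH, hW⟩

omit [Fintype Y] in
/-- the kept sup letters at WEAKER letters — constant UP (`B₃ ≤ B₃′`) and rate DOWN (`δ′ ≤ δ`) (the twin of dag-n06-w5's `letters313Z_mono`).
[cite: Balaban1985BackgroundPropagators, Thm 3.13 p.426 + (3.42) p.397 (bookkeeping); Balaban1984PropagatorsII, (2.51)–(2.54) p.232] -/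
theorem Letters313Zk.mono {𝔬 : Ops g B X Y Z W} {hG : GeoOK g} {wZ : g.Site → ℝ} {hwZ : ∀ y, 0 < wZ y} {B₃ B₃' δ₃ δ₃' : ℝ} {U : B.Cfg}
    (hB₃ : 0 ≤ B₃) (hBB : B₃ ≤ B₃') (hδ : δ₃' ≤ δ₃) (h : Letters313Zk 𝔬 R₀ H₀ hG wZ hwZ B₃ δ₃ U) :
    Letters313Zk 𝔬 R₀ H₀ hG wZ hwZ B₃' δ₃' U := by
  have hB₃' : 0 ≤ B₃' := hB₃.trans hBB
  have k : ∀ a b : g.Site, B₃ * Real.exp (-(δ₃ * g.dist a b)) ≤ B₃' * Real.exp (-(δ₃' * g.dist a b)) := fun a b =>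
    mul_le_mul hBB (Real.exp_le_exp.mpr (neg_le_neg (mul_le_mul_of_nonneg_right hδ (hG.dnn a b)))) (Real.exp_nonneg _) hB₃'
  exact ⟨h.gD2.mono k, h.gQs2.mono k, h.gQs1.mono k, h.rgd2.mono k, h.c1_2.mono k, h.c1_1.mono k, h.q2.mono k, h.q1.mono k⟩

end Letters

end

end Literature.MathematicalPhysics.QuantumFieldTheory.Balaban1983to89.B9Thm313WholeLettersCutKept
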